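import Summits.QuantumFields.YangMills.Theorems.PencilRigidityNPointIsotropyUnorderedRPTransport
import Summits.QuantumFields.YangMills.Theorems.PencilRigidityNPointIsotropyUnorderedRPCutoff

/-!
# `PencilRigidity.NPointIsotropy`, line `quarter-turn-corner-operator`: stub `stub_unorderedRP` (B1)
# — unordered reflection positivity on `⁰𝒮` from the function residual

Stub `stub_unorderedRP` of crux `stmt-QuantumFields-11686` (`Summit.QuantumFields.YangMills.Theses.PencilRigidity.NPointIsotropy`),
line `quarter-turn-corner-operator` (lead-1 skeleton `Cruxes/NPointIsotropy/Lines/quarter-turn-corner-operator.lean`),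
in the registered text.

Informal statement. Let `S₁` be a one-species Schwinger family on `ℝ⁴` with ORDERED reflection positivity E2
(`IsReflectionPositive`: Gram sums over time-ordered entries `𝒮_<`), symmetry E3 on `⁰𝒮` (`IsSymmetric`) and the
function residual `NPointRegular S₁` (every `𝔖ₙ|⁰𝒮` is integration against a function `Wₙ`, `Wₙ·F ∈ L¹`). Then E2
holds in the UNORDERED Osterwalder–Schrader form on off-diagonal entries: for off-diagonal `F₀, …, F_N` supported in
`{∀ i, xᵢ⁰ > 0}` and any tensor witnesses `H n m` of `ΘFₙ* ⊗ Fₘ`,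
`∑ₙₘ 𝔖ₙ₊ₘ(H n m) ≥ 0` (`0 ≤ re`, `im = 0`). False without the residual (landed `Negative/…`: the junk family
`𝔖₄ = J`).

Proof. (0) Witness independence: `𝔖ₙ₊ₘ(H n m) = ⟪Fₙ, Fₘ⟫_S` (`osPairing`). (1) Sector decomposition (helpers II,
`unorderedRPCutoff`): `F^{(k)}ₙ = ∑_π (T_{n,k,π})^π = c_{n,k} Fₙ` with `T_{n,k,π}` time-ORDERED and multipliers
`0 ≤ c_{n,k} ≤ n!`, `c_{n,k}(x) = 1` eventually off the equal-time walls. (2) Positivity of the regularised Gram sums: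
by sesquilinearity and the E3 transport `⟪T^π, T'^{π'}⟫_S = ⟪T, T'⟫_S` (helpers I, `unorderedRPTransport`),
`∑ₙₘ ⟪F^{(k)}ₙ, F^{(k)}ₘ⟫_S = ∑_{(n,π),(m,π')} ⟪T_{n,k,π}, T_{m,k,π'}⟫_S`, an ORDERED E2 Gram sum over the finite
family `{T_{n,k,π}}` (enumerated by `Fin N'`), hence `≥ 0`. (3) Limit `k → ∞`: `ΘF^{(k)}ₙ* ⊗ F^{(k)}ₘ` and
`ΘFₙ* ⊗ Fₘ` are off-diagonal (helpers I), so by the residual `⟪F^{(k)}ₙ, F^{(k)}ₘ⟫_S = ∫ W · r_k · (ΘFₙ* ⊗ Fₘ)` with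
`0 ≤ r_k ≤ n! m!` and `r_k → 1` off the Lebesgue-null equal-time walls (`Mopup.volume_setOf_coord_eq`); dominated
convergence gives `⟪F^{(k)}ₙ, F^{(k)}ₘ⟫_S → ⟪Fₙ, Fₘ⟫_S`, and `{0 ≤ re, im = 0}` is closed.

References: K. Osterwalder, R. Schrader, Comm. Math. Phys. 31 (1973) §2–4; 42 (1975) §4 (E2 on `𝒮₊` versus
`𝒮_<`); folklore. No `def`; helpers in the sub-namespace `UnorderedRP`.
-/

noncomputable section

namespace Summit.QuantumFields.YangMills.Theorems.NPointIsotropy.QuarterTurnCornerOperator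

open scoped BigOperators SchwartzMap ComplexConjugate
open MeasureTheory Filter Topology
open Literature.MathematicalPhysics.QuantumLattice Literature.MathematicalPhysics.AQFT
open Summit.QuantumFields.YangMills.Theorems.NPointIsotropy.Negative (E4 NPointRegular)
open Summit.QuantumFields.YangMills.Theorems.NPointIsotropy.ComplexRotationBandlimit (Mopup.volume_setOf_coord_eq)

namespace UnorderedRP

variable {n m : ℕ}

/-! ## Ordered E2 for a finite family indexed by a finite type -/

/-- **Ordered E2, finite-type form**: for a family with `IsReflectionPositive` and finitely many time-ordered test
functions `T i` (any finite index type), the Gram sum `∑ᵢⱼ ⟪T i, T j⟫_S` has nonnegative real part and vanishing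
imaginary part (enumerate the index type by `Fin N'`). [folklore] -/
theorem sum_osPairing_ordered_nonneg (S : SchwingerFamily E4) (hE2 : S.toLabelled.IsReflectionPositive)
    {ι : Type*} [Fintype ι] (deg : ι → ℕ) (T : (i : ι) → 𝓢((Fin (deg i) → E4), ℂ))
    (hT : ∀ i, IsTimeOrdered (T i)) :
    0 ≤ (∑ i, ∑ j, S.osPairing (T i) (T j)).re ∧ (∑ i, ∑ j, S.osPairing (T i) (T j)).im = 0 := by
  classical
  set e : Fin (Fintype.card ι) ≃ ι := (Fintype.equivFin ι).symm with he
  have h := hE2 (Fintype.card ι) (fun j => deg (e j)) (fun _ _ => ()) (fun j => T (e j)) (fun j => hT (e j))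
    (fun i j => (osAdjoint (T (e i))).appendTensor (T (e j))) (fun i j => isAppendTensorOf_appendTensor _ _)
  have h' : 0 ≤ (∑ i : Fin (Fintype.card ι), ∑ j : Fin (Fintype.card ι), S.osPairing (T (e i)) (T (e j))).re ∧
      (∑ i : Fin (Fintype.card ι), ∑ j : Fin (Fintype.card ι), S.osPairing (T (e i)) (T (e j))).im = 0 := h
  have hsum : (∑ i : Fin (Fintype.card ι), ∑ j : Fin (Fintype.card ι), S.osPairing (T (e i)) (T (e j))) =
      ∑ i, ∑ j, S.osPairing (T i) (T j) :=
    Fintype.sum_equiv e _ _ fun i => Fintype.sum_equiv e _ _ fun j => rfl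
  rw [hsum] at h'
  exact h'

/-! ## Off-diagonality and positivity of supports for finite sums -/

/-- `⁰𝒮` is stable under finite sums. [folklore] -/
theorem isOffDiagonal_sum {ι : Type*} (s : Finset ι) (G : ι → 𝓢((Fin n → E4), ℂ))
    (h : ∀ i ∈ s, IsOffDiagonal (G i)) : IsOffDiagonal (∑ i ∈ s, G i) :=
  Finset.sum_induction _ (fun G : 𝓢((Fin n → E4), ℂ) => IsOffDiagonal G) (fun _ _ ha hb => ha.add hb)
    isOffDiagonal_zero h

/-- A pointwise multiple `x ↦ c(x) F(x)` of a positive-time test function is positive-time. [folklore] -/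
theorem isPositiveTimeMulti_of_apply_eq_mul {F G : 𝓢((Fin n → E4), ℂ)} (hF : IsPositiveTimeMulti F)
    (c : (Fin n → E4) → ℝ) (hG : ∀ x, G x = (c x : ℂ) * F x) : IsPositiveTimeMulti G := by
  refine (closure_mono fun x hx => ?_).trans hF
  rw [Function.mem_support] at hx ⊢
  intro h0
  exact hx (by rw [hG x, h0, mul_zero])

/-! ## The limit: dominated convergence off the equal-time walls -/

/-- **The regularised pairings converge.** If `A_k = a_k · A`, `B_k = b_k · B` pointwise with off-diagonal positive-time
`A, B, A_k, B_k`, bounded nonnegative multipliers and `a_k(x) = 1 = b_k(y)` eventually at all configurations with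
pairwise distinct times, then `⟪A_k, B_k⟫_S → ⟪A, B⟫_S` for an `NPointRegular` family: both pairings are integrals
against `W_{n+m}`, the integrands are dominated by `C ‖W · (ΘA* ⊗ B)‖` and converge off the null equal-time walls.
[folklore] -/
theorem tendsto_osPairing (S : SchwingerFamily E4) (hreg : NPointRegular S)
    {A : 𝓢((Fin n → E4), ℂ)} {B : 𝓢((Fin m → E4), ℂ)}
    (hA : IsPositiveTimeMulti A) (hAo : IsOffDiagonal A) (hB : IsPositiveTimeMulti B) (hBo : IsOffDiagonal B)
    (Ak : ℕ → 𝓢((Fin n → E4), ℂ)) (Bk : ℕ → 𝓢((Fin m → E4), ℂ))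
    (hAk : ∀ k, IsPositiveTimeMulti (Ak k)) (hAko : ∀ k, IsOffDiagonal (Ak k))
    (hBk : ∀ k, IsPositiveTimeMulti (Bk k)) (hBko : ∀ k, IsOffDiagonal (Bk k))
    (a : ℕ → (Fin n → E4) → ℝ) (b : ℕ → (Fin m → E4) → ℝ)
    (ha : ∀ k x, Ak k x = (a k x : ℂ) * A x) (hb : ∀ k x, Bk k x = (b k x : ℂ) * B x)
    (Ca Cb : ℝ) (ha0 : ∀ k x, 0 ≤ a k x ∧ a k x ≤ Ca) (hb0 : ∀ k x, 0 ≤ b k x ∧ b k x ≤ Cb)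
    (ha1 : ∀ x, Function.Injective (fun i => x i 0) → ∀ᶠ k in atTop, a k x = 1)
    (hb1 : ∀ x, Function.Injective (fun i => x i 0) → ∀ᶠ k in atTop, b k x = 1) :
    Tendsto (fun k => S.osPairing (Ak k) (Bk k)) atTop (𝓝 (S.osPairing A B)) := by
  obtain ⟨W, hW⟩ := hreg (n + m)
  set Φ : 𝓢((Fin (n + m) → E4), ℂ) := (osAdjoint A).appendTensor B with hΦdef
  have hΦ : IsOffDiagonal Φ := isOffDiagonal_osAdjoint_appendTensor hA hAo hB hBo
  have hΦk : ∀ k, IsOffDiagonal ((osAdjoint (Ak k)).appendTensor (Bk k)) := fun k =>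
    isOffDiagonal_osAdjoint_appendTensor (hAk k) (hAko k) (hBk k) (hBko k)
  -- the multipliers seen by the OS tensor
  set r : ℕ → (Fin (n + m) → E4) → ℝ := fun k x =>
    a k (fun i => timeReflection 4 (x (Fin.castAdd m (Fin.rev i)))) * b k (fun j => x (Fin.natAdd n j)) with hrdef
  have hfac : ∀ k x, ((osAdjoint (Ak k)).appendTensor (Bk k)) x = (r k x : ℂ) * Φ x := by
    intro k x
    simp only [hΦdef, hrdef, SchwartzMap.appendTensor_apply, osAdjoint_apply, Function.comp_def, ha, hb,
      map_mul, Complex.conj_ofReal, Complex.ofReal_mul]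
    ring
  have hr0 : ∀ k x, 0 ≤ r k x ∧ r k x ≤ Ca * Cb := by
    intro k x
    have h1 := ha0 k fun i => timeReflection 4 (x (Fin.castAdd m (Fin.rev i)))
    have h2 := hb0 k fun j => x (Fin.natAdd n j)
    exact ⟨mul_nonneg h1.1 h2.1, mul_le_mul h1.2 h2.2 h2.1 (h1.1.trans h1.2)⟩
  -- integral representations
  have hfun : (fun k => S.osPairing (Ak k) (Bk k)) =
      fun k => ∫ x, W x * ((osAdjoint (Ak k)).appendTensor (Bk k)) x := funext fun k => (hW _ (hΦk k)).2
  rw [hfun, show S.osPairing A B = ∫ x, W x * Φ x from (hW _ hΦ).2]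
  refine tendsto_integral_of_dominated_convergence (fun x => Ca * Cb * ‖W x * Φ x‖)
    (fun k => (hW _ (hΦk k)).1.aestronglyMeasurable) ((hW _ hΦ).1.norm.const_mul _)
    (fun k => ae_of_all _ fun x => ?_) ?_
  · -- domination
    rw [hfac k x, norm_mul, norm_mul, Complex.norm_real, Real.norm_of_nonneg (hr0 k x).1, norm_mul]
    have hW0 : 0 ≤ ‖W x‖ := norm_nonneg _
    have hΦ0 : 0 ≤ ‖Φ x‖ := norm_nonneg _
    calc ‖W x‖ * (r k x * ‖Φ x‖) = r k x * (‖W x‖ * ‖Φ x‖) := by ring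
      _ ≤ Ca * Cb * (‖W x‖ * ‖Φ x‖) := mul_le_mul_of_nonneg_right (hr0 k x).2 (mul_nonneg hW0 hΦ0)
  · -- convergence off the equal-time walls
    have hZ : volume (⋃ p : Fin (n + m), ⋃ q : Fin (n + m), ⋃ (_ : p ≠ q),
        {x : Fin (n + m) → E4 | x p 0 = x q 0}) = 0 :=
      measure_iUnion_null fun p => measure_iUnion_null fun q => measure_iUnion_null fun hpq =>
        Mopup.volume_setOf_coord_eq p q hpq 0
    filter_upwards [compl_mem_ae_iff.2 hZ] with x hx
    have hinj : Function.Injective fun p => x p 0 := by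
      intro p q hpq
      by_contra hne
      exact hx (Set.mem_iUnion.2 ⟨p, Set.mem_iUnion.2 ⟨q, Set.mem_iUnion.2 ⟨hne, hpq⟩⟩⟩)
    have h1 : Function.Injective fun i : Fin n =>
        (fun i => timeReflection 4 (x (Fin.castAdd m (Fin.rev i)))) i 0 := by
      intro i j hij
      have hij' : -x (Fin.castAdd m (Fin.rev i)) 0 = -x (Fin.castAdd m (Fin.rev j)) 0 := by
        simpa [timeReflection_apply] using hij
      exact Fin.rev_injective (Fin.castAdd_injective _ _ (hinj (neg_injective hij')))
    have h2 : Function.Injective fun j : Fin m => (fun j => x (Fin.natAdd n j)) j 0 :=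
      fun i j hij => Fin.natAdd_injective _ _ (hinj hij)
    refine (tendsto_const_nhds (x := W x * Φ x)).congr' ?_
    filter_upwards [ha1 _ h1, hb1 _ h2] with k hka hkb
    rw [hfac k x]
    simp [hrdef, hka, hkb]

/-! ## Unordered reflection positivity on `⁰𝒮` -/

/-- **Unordered E2 on `⁰𝒮` from ordered E2, E3 and the function residual** (the content of `stub_unorderedRP`, in
`osPairing` form): for off-diagonal positive-time `F₀, …, F_N`, `∑ₙₘ ⟪Fₙ, Fₘ⟫_S` has nonnegative real part and zero
imaginary part. [folklore] -/
theorem sum_osPairing_nonneg (S : SchwingerFamily E4) (hE2 : S.toLabelled.IsReflectionPositive)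
    (hE3 : S.toLabelled.IsSymmetric) (hreg : NPointRegular S) (N : ℕ) (F : (n : ℕ) → 𝓢((Fin n → E4), ℂ))
    (hFpos : ∀ n, IsPositiveTimeMulti (F n)) (hFoff : ∀ n, IsOffDiagonal (F n)) :
    0 ≤ (∑ n ∈ Finset.range (N + 1), ∑ m ∈ Finset.range (N + 1), S.osPairing (F n) (F m)).re ∧
      (∑ n ∈ Finset.range (N + 1), ∑ m ∈ Finset.range (N + 1), S.osPairing (F n) (F m)).im = 0 := by
  classical
  -- (1) sector decomposition of every `F n`
  choose T c hT hTsum hc hc1 using fun n => exists_orderedPieces (F n) (hFpos n)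
  set Fk : (n : ℕ) → ℕ → 𝓢((Fin n → E4), ℂ) := fun n k => ∑ π, permTest π (T n k π) with hFkdef
  have hFk_apply : ∀ n k x, Fk n k x = (c n k x : ℂ) * F n x := fun n k x => hTsum n k x
  have hFk_pos : ∀ n k, IsPositiveTimeMulti (Fk n k) := fun n k =>
    isPositiveTimeMulti_of_apply_eq_mul (hFpos n) (c n k) (hFk_apply n k)
  have hFk_off : ∀ n k, IsOffDiagonal (Fk n k) := fun n k =>
    isOffDiagonal_sum _ _ fun π _ => isOffDiagonal_permTest (hT n k π).isOffDiagonal π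
  -- (2) positivity of the regularised Gram sums
  have hposk : ∀ k,
      0 ≤ (∑ n ∈ Finset.range (N + 1), ∑ m ∈ Finset.range (N + 1), S.osPairing (Fk n k) (Fk m k)).re ∧
        (∑ n ∈ Finset.range (N + 1), ∑ m ∈ Finset.range (N + 1), S.osPairing (Fk n k) (Fk m k)).im = 0 := by
    intro k
    have hexp : (∑ n ∈ Finset.range (N + 1), ∑ m ∈ Finset.range (N + 1), S.osPairing (Fk n k) (Fk m k)) =
        ∑ n ∈ Finset.range (N + 1), ∑ m ∈ Finset.range (N + 1),
          ∑ π : Equiv.Perm (Fin n), ∑ π' : Equiv.Perm (Fin m), S.osPairing (T n k π) (T m k π') := by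
      refine Finset.sum_congr rfl fun n _ => Finset.sum_congr rfl fun m _ => ?_
      rw [hFkdef]
      dsimp only
      rw [osPairing_sum_sum]
      refine Finset.sum_congr rfl fun π _ => Finset.sum_congr rfl fun π' _ => ?_
      exact osPairing_permTest S hE3 (isOffDiagonal_osAdjoint_appendTensor (hT n k π).isPositiveTimeMulti
        (hT n k π).isOffDiagonal (hT m k π').isPositiveTimeMulti (hT m k π').isOffDiagonal) π π'
    have h := sum_osPairing_ordered_nonneg S hE2 (ι := Σ a : Fin (N + 1), Equiv.Perm (Fin a))
      (fun I => (I.1 : ℕ)) (fun I => T I.1 k I.2) (fun I => hT _ k _)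
    have hconv : (∑ I : (Σ a : Fin (N + 1), Equiv.Perm (Fin a)), ∑ J : (Σ a : Fin (N + 1), Equiv.Perm (Fin a)),
        S.osPairing (T I.1 k I.2) (T J.1 k J.2)) =
        ∑ n ∈ Finset.range (N + 1), ∑ m ∈ Finset.range (N + 1),
          ∑ π : Equiv.Perm (Fin n), ∑ π' : Equiv.Perm (Fin m), S.osPairing (T n k π) (T m k π') := by
      have hinner : ∀ I : (Σ a : Fin (N + 1), Equiv.Perm (Fin a)),
          (∑ J : (Σ a : Fin (N + 1), Equiv.Perm (Fin a)), S.osPairing (T I.1 k I.2) (T J.1 k J.2)) =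
            ∑ m ∈ Finset.range (N + 1), ∑ π' : Equiv.Perm (Fin m), S.osPairing (T I.1 k I.2) (T m k π') := by
        intro I
        rw [Fintype.sum_sigma]
        exact Fin.sum_univ_eq_sum_range
          (fun m => ∑ π' : Equiv.Perm (Fin m), S.osPairing (T I.1 k I.2) (T m k π')) (N + 1)
      simp only [hinner]
      rw [Fintype.sum_sigma]
      rw [Fin.sum_univ_eq_sum_range (fun n => ∑ π : Equiv.Perm (Fin n),
        ∑ m ∈ Finset.range (N + 1), ∑ π' : Equiv.Perm (Fin m), S.osPairing (T n k π) (T m k π')) (N + 1)]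
      refine Finset.sum_congr rfl fun n _ => ?_
      rw [Finset.sum_comm]
    rw [hexp, ← hconv]
    exact h
  -- (3) the limit `k → ∞`
  have hlim : Tendsto (fun k => ∑ n ∈ Finset.range (N + 1), ∑ m ∈ Finset.range (N + 1),
      S.osPairing (Fk n k) (Fk m k)) atTop
      (𝓝 (∑ n ∈ Finset.range (N + 1), ∑ m ∈ Finset.range (N + 1), S.osPairing (F n) (F m))) := by
    refine tendsto_finsetSum _ fun n _ => tendsto_finsetSum _ fun m _ => ?_
    exact tendsto_osPairing S hreg (hFpos n) (hFoff n) (hFpos m) (hFoff m) (fun k => Fk n k) (fun k => Fk m k)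
      (fun k => hFk_pos n k) (fun k => hFk_off n k) (fun k => hFk_pos m k) (fun k => hFk_off m k) (c n) (c m)
      (hFk_apply n) (hFk_apply m) _ _ (hc n) (hc m) (hc1 n) (hc1 m)
  -- (4) closedness of `{0 ≤ re, im = 0}`
  have hre := (Complex.continuous_re.tendsto _).comp hlim
  have him := (Complex.continuous_im.tendsto _).comp hlim
  refine ⟨ge_of_tendsto' hre fun k => (hposk k).1, ?_⟩
  have h0 : ((fun z : ℂ => z.im) ∘ fun k => ∑ n ∈ Finset.range (N + 1), ∑ m ∈ Finset.range (N + 1),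
      S.osPairing (Fk n k) (Fk m k)) = fun _ => (0 : ℝ) := funext fun k => (hposk k).2
  rw [h0] at him
  exact (tendsto_nhds_unique tendsto_const_nhds him).symm

end UnorderedRP

/-- **Stub B1 `stub_unorderedRP` — unordered reflection positivity on `⁰𝒮` from the function residual** (crux
`PencilRigidity.NPointIsotropy`, stmt-QuantumFields-11686, line `quarter-turn-corner-operator`; registered text).
For a one-species family with ORDERED E2 (`IsReflectionPositive`: time-ordered entries), E3 (`IsSymmetric` on `⁰𝒮`)
and every `𝔖ₙ|⁰𝒮` a function (`NPointRegular`), E2 holds in the UNORDERED `𝒮₊` form on off-diagonal entries: for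
positive-time-supported, off-diagonal `F₀,…,F_N` and any tensor witnesses `H n m` of `ΘFₙ* ⊗ Fₘ`,
`∑ₙₘ 𝔖ₙ₊ₘ(H n m) ≥ 0`. Witness independence (`osPairing_eq_of_isAppendTensorOf`) +
`UnorderedRP.sum_osPairing_nonneg`. [folklore] -/
theorem stub_unorderedRP :
    open Literature.MathematicalPhysics.QuantumLattice Literature.MathematicalPhysics.AQFT
      Summit.QuantumFields.YangMills.Theorems.NPointIsotropy.Negative in
    ∀ (S₁ : SchwingerFamily E4), S₁.toLabelled.IsReflectionPositive → S₁.toLabelled.IsSymmetric →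
      NPointRegular S₁ →
      ∀ (N : ℕ) (F : (n : ℕ) → SchwartzMap (Fin n → E4) ℂ),
        (∀ n, N < n → F n = 0) → (∀ n, IsPositiveTimeMulti (F n)) → (∀ n, IsOffDiagonal (F n)) →
        ∀ H : (n m : ℕ) → SchwartzMap (Fin (n + m) → E4) ℂ,
          (∀ n m, IsAppendTensorOf (H n m) (osAdjoint (F n)) (F m)) →
          0 ≤ (∑ n ∈ Finset.range (N + 1), ∑ m ∈ Finset.range (N + 1), S₁ (n + m) (H n m)).re ∧
            (∑ n ∈ Finset.range (N + 1), ∑ m ∈ Finset.range (N + 1), S₁ (n + m) (H n m)).im = 0 := by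
  intro S₁ hE2 hE3 hreg N F _ hFpos hFoff H hH
  have hsum : (∑ n ∈ Finset.range (N + 1), ∑ m ∈ Finset.range (N + 1), S₁ (n + m) (H n m)) =
      ∑ n ∈ Finset.range (N + 1), ∑ m ∈ Finset.range (N + 1), S₁.osPairing (F n) (F m) :=
    Finset.sum_congr rfl fun n _ => Finset.sum_congr rfl fun m _ => S₁.osPairing_eq_of_isAppendTensorOf (hH n m)
  rw [hsum]
  exact UnorderedRP.sum_osPairing_nonneg S₁ hE2 hE3 hreg N F hFpos hFoff

end Summit.QuantumFields.YangMills.Theorems.NPointIsotropy.QuarterTurnCornerOperator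

end
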